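import Summits.AnomalousDissipation.AnomalousDissipation.Theorems.SawtoothPulseCascadeK1LocalisedCascadeHalfStepV
import Summits.AnomalousDissipation.AnomalousDissipation.Theorems.SawtoothPulseCascadeK1LocalisedCascadeTrapezoidFejer
import Summits.AnomalousDissipation.AnomalousDissipation.Theorems.SawtoothPulseCascadeK1LocalisedCascadeCornerEnvelope

/-!
# K1loc, line `Spectral` / thin start — helper: THE V HALF-STEP WITH FEJÉR KERNEL BOUNDS AND THE DECAYING MAJORANT (sharp constants)

Helper file of the prover lane on the crux `K1LocalisedCascade` (stmt-AnomalousDissipation-19491), route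
`SawtoothPulseCascade` (S-D fibre ledger; memo v9 §9 (c)).  The V half-step window inequality `…HalfStepV.sum_window_sq_norm_vstep_le`
with the two constants levers in place: the input cut-off `χ` and the per-fibre mid-band symbols `ψ_n` are TRAPEZOIDS, whose
kernels are differences of Fejér kernels (`…TrapezoidFejer`: `∫|k| ≤ (L₁+L₂)/D`, tail `≤ π/(Dδ)`), and the mid-band part of
the chirp is dominated by the DECAYING corner envelope `ρ = ε₀ + A·d₀/max(infDist(·,C_N), d₀)` (`…CornerEnvelope`), whose `L²`
mass is `≤ 2ε₀² + 2A²·(2N_j)·2πd₀` — linear in the layer scale, no tail-radius inflation: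
**`sum_window_sq_norm_vstep_sharp_le`** —
`Σ_{k∈W}‖𝓕(b∘Φ_V)(k)‖² ≤ (((Q₁+Q₂)/(Q₂−Q₁))·√(2ε₀² + 2A²(2N_j)(2πd₀)) + √(Σ_{n∈F}∫‖A¹_n(b − T_χb)‖²))²`
under `A ≥ (P₁+P₂)/(P₂−P₁) + 2`, `4π ≤ A·d₀·(P₂−P₁)`, `Mδ_j < 2πN_j d₀`, `ε₀ ≥ π|nγ|e^{−M²/2}/N_j` on the fibres of `W`.
No definitions; no statement about the crux. [cite: Grafakos2014, Prop. 3.1.2 (5), §3.1.3]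
[cite: ElgindiLissMattingly2025, §1 (slope ±1 branches)] [problem: turb]
-/

-- `Summit.<Summit>.<Problem>`: single-conjunct summit, the duplicate namespace segment is deliberate.
set_option linter.dupNamespace false

noncomputable section

namespace Summit.AnomalousDissipation.AnomalousDissipation.Theorems.SawtoothPulseCascade.K1Window

open MeasureTheory Set Filter Topology UnitAddTorus Function Complex Metric
open scoped Real ENNReal
open Literature.Analysis Literature.Analysis.FunctionSpaces Literature.Analysis.FunctionSpaces.Torus Literature.Analysis.FluidPDE
open Literature.Analysis.FluidPDE.ShearStage
open Literature.Analysis.FluidPDE.SawtoothCascade Literature.Analysis.FluidPDE.SawtoothCascade.CascadeParams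
open Summit.AnomalousDissipation.AnomalousDissipation.Theorems.SawtoothPulseCascade.K1Start
open Summit.AnomalousDissipation.AnomalousDissipation.Theorems.SawtoothPulseCascade.K1Flat

/-! ## The sharp V half-step -/

/-- **THE V HALF-STEP WITH SHARP CONSTANTS** (see the file header). [cite: Grafakos2014, §3.1.3] -/
theorem sum_window_sq_norm_vstep_sharp_le (P : CascadeParams) {G : ℕ} (hγ : P.γ = G) (hδ₀ : 0 < P.δ₀) (hd : 0 < P.d)
    (hN₀ : 1 ≤ P.N₀) (hρN : 1 ≤ P.ρN) (j : ℕ)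
    {b : UnitAddTorus (Fin 2) → ℂ} (hb : Continuous b) (hbs : Summable fun k => ‖mFourierCoeff b k‖) (hb1 : ∀ x, ‖b x‖ ≤ 1)
    (W : Finset (Fin 2 → ℤ))
    -- input cut-off: a trapezoid in `k₀` with plateau `Q₁`, support `Q₂`
    (χ : ℤ → ℂ) {Q₁ Q₂ : ℕ} (hQ : Q₁ < Q₂)
    (hχ : ∀ m : ℤ, χ m = ((min 1 (max 0 (((Q₂ : ℝ) - |(m : ℝ)|) / ((Q₂ : ℝ) - Q₁))) : ℝ) : ℂ))
    -- per-fibre mid-band trapezoids with plateau `P₁ n`, support `P₂ n ≤ |nγ|`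
    (ψ : ℤ → ℤ → ℂ) (P₁ P₂ : ℤ → ℕ) (hP : ∀ k ∈ W, P₁ (k 1) < P₂ (k 1))
    (hψ : ∀ k ∈ W, ∀ m : ℤ, ψ (k 1) m =
      ((min 1 (max 0 (((P₂ (k 1) : ℝ) - |(m : ℝ)|) / ((P₂ (k 1) : ℝ) - P₁ (k 1)))) : ℝ) : ℂ))
    (hP₂ : ∀ k ∈ W, (P₂ (k 1) : ℤ) ≤ |k 1 * G|) (hP₁ : ∀ k ∈ W, |k 0| + Q₂ ≤ (P₁ (k 1) : ℤ))
    -- layer scale, zone depth, envelope constants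
    {d₀ M ε₀ A : ℝ} (hd₀ : 0 < d₀) (hM : 1 ≤ M) (hMδ : M * P.δ j < π / 2) (hMd : M * P.δ j < 2 * π * P.N j * d₀)
    (hA0 : 0 ≤ A) (hA : ∀ k ∈ W, ((P₁ (k 1) : ℝ) + P₂ (k 1)) / ((P₂ (k 1) : ℝ) - P₁ (k 1)) + 2 ≤ A)
    (hAd : ∀ k ∈ W, 4 * π ≤ A * d₀ * ((P₂ (k 1) : ℝ) - P₁ (k 1)))
    (hε0 : 0 ≤ ε₀) (hε : ∀ k ∈ W, 2 * π * |((k 1 * G : ℤ) : ℝ)| * (Real.exp (-(M ^ 2 / 2)) / (2 * P.N j)) ≤ ε₀) :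
    ∑ k ∈ W, ‖mFourierCoeff (b ∘ shearMap 1 0 (amp ⟨P.U j, P.U_periodic j, P.contDiff_U (P.δ_pos hδ₀ hd j)⟩ P.γ)) k‖ ^ 2 ≤
      ((((Q₁ : ℝ) + Q₂) / ((Q₂ : ℝ) - Q₁)) *
          Real.sqrt (2 * ε₀ ^ 2 + 2 * A ^ 2 * ((2 * P.N j : ℕ) * (2 * π * d₀))) +
        Real.sqrt (∑ n ∈ W.image (fun k => k 1), ∫ x : UnitAddTorus (Fin 2),
          ‖∫ s : UnitAddCircle, (fourier (-n) s : ℂ) •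
            (b (x + Pi.single (1 : Fin 2) s) - ∑ l ∈ Finset.Icc (-(Q₂ : ℤ)) Q₂, χ l * ∫ s' : UnitAddCircle,
              (fourier (-l) s' : ℂ) • b (x + Pi.single (1 : Fin 2) s + Pi.single (0 : Fin 2) s'))‖ ^ 2)) ^ 2 := by
  classical
  have h10 : (1 : Fin 2) ≠ 0 := by decide
  have hπ : 0 < π := Real.pi_pos
  have hN : P.N j ≠ 0 := (N_pos P hN₀ hρN j).ne'
  have hNpos : 0 < P.N j := Nat.pos_of_ne_zero hN
  have hNr : (0 : ℝ) < P.N j := by exact_mod_cast hNpos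
  have hc : 0 < 2 * π * (P.N j : ℝ) := by positivity
  set Ψ : ShearProfile := amp ⟨P.U j, P.U_periodic j, P.contDiff_U (P.δ_pos hδ₀ hd j)⟩ P.γ with hΨ
  have hΨt : ∀ t : ℝ, Ψ t = P.γ * P.U j t := fun t => amp_apply _ _ _
  -- the input cut-off and its complement
  have hχS : ∀ l, l ∉ Finset.Icc (-(Q₂ : ℤ)) Q₂ → χ l = 0 := trapezoid_support hQ hχ
  have hχ1 : ∀ l, ‖χ l‖ ≤ 1 := fun l => (trapezoid_values hQ hχ l).2.2
  have hχL : ∀ l, χ l ≠ 0 → |l| < (Q₂ : ℤ) := fun l hl => by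
    by_contra h; push Not at h; exact hl ((trapezoid_values hQ hχ l).2.1 h)
  set T : UnitAddTorus (Fin 2) → ℂ := fun x => ∑ l ∈ Finset.Icc (-(Q₂ : ℤ)) Q₂, χ l *
    ∫ s : UnitAddCircle, (fourier (-l) s : ℂ) • b (x + Pi.single (0 : Fin 2) s) with hT
  have hTc : Continuous T := continuous_finsetSum _ fun l _ => continuous_const.mul (continuous_twistedAxisAvg hb 0 l)
  have hTcoef : ∀ k, mFourierCoeff T k = χ (k 0) * mFourierCoeff b k := fun k => mFourierCoeff_axisCutoff hb 0 hχS k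
  have hTs : Summable fun k => ‖mFourierCoeff T k‖ := by
    refine Summable.of_nonneg_of_le (fun k => norm_nonneg _) (fun k => ?_) hbs
    rw [hTcoef k, norm_mul]
    exact mul_le_of_le_one_left (norm_nonneg _) (hχ1 _)
  set θ₂ : UnitAddTorus (Fin 2) → ℂ := fun x => b x - T x with hθ₂
  have hθ₂c : Continuous θ₂ := hb.sub hTc
  have hsum : (fun x => T x + θ₂ x) = b := by funext x; simp [hθ₂]
  -- the exact chirps, the circle kernels, the chirp split
  set g0 : ℤ → UnitAddCircle → ℂ := fun n => (periodic_exactChirpFun (P.N j) (n * G)).lift with hg0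
  have hg0c : ∀ n, Continuous (g0 n) := fun n => (continuous_exactChirp_lift (P.N j) (n * G)).1
  have hg0t : ∀ n (t : ℝ), g0 n (t : UnitAddCircle) =
      Complex.exp (-(2 * π * I * ((n * G : ℤ)) * ((tri (2 * π * P.N j * t) / (2 * π * P.N j) : ℝ) : ℂ))) :=
    fun n t => (continuous_exactChirp_lift (P.N j) (n * G)).2 t
  have hg01 : ∀ n bb, ‖g0 n bb‖ ≤ 1 := by
    intro n bb
    obtain ⟨t, rfl⟩ := QuotientAddGroup.mk_surjective bb
    rw [hg0t]; exact norm_exp_chirp_le _ _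
  set kψ : ℤ → UnitAddCircle → ℂ := fun n s => ∑ m ∈ Finset.Icc (-(P₂ n : ℤ)) (P₂ n), ψ n m * fourier (-m) s with hkψ
  have hkψc : ∀ n, Continuous (kψ n) := fun n =>
    continuous_finsetSum _ fun m _ => continuous_const.mul (fourier (-m)).continuous
  set gmid : ℤ → UnitAddCircle → ℂ := fun n bb => (∫ s : UnitAddCircle, kψ n s * g0 n (bb + s)) + (twist Ψ n bb - g0 n bb)
    with hgmid
  set grest : ℤ → UnitAddCircle → ℂ := fun n bb => g0 n bb - ∫ s : UnitAddCircle, kψ n s * g0 n (bb + s) with hgrest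
  have hgmidc : ∀ n, Continuous (gmid n) := fun n =>
    (continuous_circleCutoff (hkψc n) (hg0c n)).add ((continuous_twist Ψ n).sub (hg0c n))
  have hgrestc : ∀ n, Continuous (grest n) := fun n => (hg0c n).sub (continuous_circleCutoff (hkψc n) (hg0c n))
  have hsplit : ∀ k ∈ W, ∀ bb, twist Ψ (k 1) bb = gmid (k 1) bb + grest (k 1) bb := by
    intro k _ bb; simp only [hgmid, hgrest]; ring
  -- exact separation
  have hsep : ∀ k ∈ W, ∀ m : ℤ, fourierCoeff (grest (k 1)) m * mFourierCoeff T (k - Pi.single 0 m) = 0 := by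
    intro k hk m
    rw [hTcoef]
    have e0 : (k - Pi.single (0 : Fin 2) m : Fin 2 → ℤ) 0 = k 0 - m := by simp
    rw [e0]
    by_cases hχ0 : χ (k 0 - m) = 0
    · rw [hχ0, zero_mul, mul_zero]
    · have hl : |k 0 - m| < (Q₂ : ℤ) := hχL _ hχ0
      have hψm : ψ (k 1) m = 1 := by
        refine (trapezoid_values (hP k hk) (hψ k hk) m).1 ?_
        have h1 := hP₁ k hk
        have h2 := abs_sub_abs_le_abs_sub m (k 0)
        rw [abs_sub_comm m (k 0)] at h2
        linarith
      have hψS' : ∀ m', m' ∉ Finset.Icc (-(P₂ (k 1) : ℤ)) (P₂ (k 1)) → ψ (k 1) m' = 0 :=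
        trapezoid_support (hP k hk) (hψ k hk)
      have hcoef : fourierCoeff (grest (k 1)) m = 0 := by
        simp only [hgrest]
        rw [fourierCoeff_sub_of_continuous (hg0c _) (continuous_circleCutoff (hkψc _) (hg0c _)),
          show (fun y : UnitAddCircle => ∫ s : UnitAddCircle, kψ (k 1) s * g0 (k 1) (y + s)) =
            (fun y : UnitAddCircle => ∫ s : UnitAddCircle, (∑ m' ∈ Finset.Icc (-(P₂ (k 1) : ℤ)) (P₂ (k 1)),
              ψ (k 1) m' * fourier (-m') s) * g0 (k 1) (y + s)) from rfl,
          fourierCoeff_circleCutoff (hg0c _) hψS' m, hψm, one_mul, sub_self]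
      rw [hcoef, zero_mul]
  -- the corner set, the majorant
  set CF : Finset UnitAddCircle := (Finset.Ico (0 : ℤ) (2 * P.N j)).image
      fun l : ℤ => (((2 * (l : ℝ) + 1) / (4 * P.N j) : ℝ) : UnitAddCircle) with hCF
  have hCFne : CF.Nonempty :=
    Finset.Nonempty.image ⟨0, Finset.mem_Ico.mpr ⟨le_rfl, by exact_mod_cast (by omega : 0 < 2 * P.N j)⟩⟩ _
  have hCFcard : (CF.card : ℝ) ≤ (2 * P.N j : ℕ) := by
    have h1 : CF.card ≤ (Finset.Ico (0 : ℤ) (2 * P.N j)).card := Finset.card_image_le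
    rw [Int.card_Ico] at h1
    exact_mod_cast (by omega : CF.card ≤ 2 * P.N j)
  set C : Set UnitAddCircle := (CF : Set UnitAddCircle) with hC
  set ρ : UnitAddCircle → ℝ := fun bb => ε₀ + A * (d₀ / max (infDist bb C) d₀) with hρ
  obtain ⟨hρc, hρ0, hρcore, hρoff⟩ := envelope_facts C hε0 hA0 hd₀
  have hbd : ∀ k ∈ W, ∀ bb, ‖gmid (k 1) bb‖ ≤ ρ bb := by
    intro k hk bb
    have hPk := hP k hk
    have hψk := hψ k hk
    have hDk : (0 : ℝ) < (P₂ (k 1) : ℝ) - P₁ (k 1) := by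
      have : (P₁ (k 1) : ℝ) < P₂ (k 1) := by exact_mod_cast hPk
      linarith
    -- `L¹` norm of the fibre kernel via Fejér
    have hkψ1 : (∫ s : UnitAddCircle, ‖kψ (k 1) s‖) + 2 ≤ A := by
      have h := integral_norm_trapezoidKernel_le_ratio hPk hψk
      have h' : (∫ s : UnitAddCircle, ‖kψ (k 1) s‖) ≤ ((P₁ (k 1) : ℝ) + P₂ (k 1)) / ((P₂ (k 1) : ℝ) - P₁ (k 1)) := by
        simpa only [hkψ] using h
      linarith [hA k hk]
    -- the crude bound `A`, valid everywhere
    have hcrude : ‖gmid (k 1) bb‖ ≤ A := by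
      have h1 : ‖∫ s : UnitAddCircle, kψ (k 1) s * g0 (k 1) (bb + s)‖ ≤ (∫ s : UnitAddCircle, ‖kψ (k 1) s‖) * 1 :=
        norm_circleCutoff_le (hkψc _) (hg0c _) (hg01 _) bb
      have h2 : ‖twist Ψ (k 1) bb - g0 (k 1) bb‖ ≤ 2 := by
        refine (norm_sub_le _ _).trans ?_
        have := hg01 (k 1) bb
        rw [norm_twist]; linarith
      simp only [hgmid]
      refine (norm_add_le _ _).trans ?_
      linarith
    by_cases hcore : infDist bb C ≤ d₀
    · simp only [hρ]
      rw [hρcore bb hcore]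
      linarith [hcrude]
    · -- off the core: orthogonality + decaying kernel tail at radius `infDist/2`, rounding off the `Mδ`-zone
      push Not at hcore
      have hdpos : 0 < infDist bb C := hd₀.trans hcore
      obtain ⟨t, rfl⟩ := QuotientAddGroup.mk_surjective bb
      have hfar := phase_far_of_le_infDist hNpos (le_refl (infDist ((t : ℝ) : UnitAddCircle) C))
      have hfar1 : ∀ m : ℤ, π * P.N j * infDist ((t : ℝ) : UnitAddCircle) C < |2 * π * P.N j * t - (π / 2 + π * m)| :=
        fun m => lt_of_lt_of_le (by nlinarith [mul_pos (mul_pos hπ hNr) hdpos]) (hfar m)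
      have hfar2 : ∀ m : ℤ, M * P.δ j < |2 * π * P.N j * t - (π / 2 + π * m)| := fun m =>
        lt_of_lt_of_le (hMd.trans_le (by nlinarith [mul_pos (mul_pos hπ hNr) hdpos, hcore.le])) (hfar m)
      -- mid-band part
      have hψ0p : ψ (k 1) (k 1 * G) = 0 := (trapezoid_values hPk hψk _).2.1 (hP₂ k hk)
      have hψ0m : ψ (k 1) (-(k 1 * G)) = 0 := (trapezoid_values hPk hψk _).2.1 (by rw [abs_neg]; exact hP₂ k hk)
      have h1 := norm_circleCutoff_exactChirp_le hNpos (hg0c (k 1)) (hg0t (k 1)) (Finset.Icc (-(P₂ (k 1) : ℤ)) (P₂ (k 1)))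
        hψ0p hψ0m hfar1
      have hr : π * ↑(P.N j) * infDist ((t : ℝ) : UnitAddCircle) C / (2 * π * ↑(P.N j)) =
          infDist ((t : ℝ) : UnitAddCircle) C / 2 := by field_simp
      rw [hr] at h1
      have htail := setIntegral_norm_trapezoidKernel_le hPk hψk (δ := infDist ((t : ℝ) : UnitAddCircle) C / 2) (by positivity)
        (E := {s : UnitAddCircle | infDist ((t : ℝ) : UnitAddCircle) C / 2 ≤ ‖s‖})
        (measurableSet_le measurable_const continuous_norm.measurable) (fun s hs => hs)
      have h1' : ‖∫ s : UnitAddCircle, kψ (k 1) s * g0 (k 1) ((t : UnitAddCircle) + s)‖ ≤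
          2 * (π / (((P₂ (k 1) : ℝ) - P₁ (k 1)) * (infDist ((t : ℝ) : UnitAddCircle) C / 2))) := by
        have h1'' : ‖∫ s : UnitAddCircle, kψ (k 1) s * g0 (k 1) ((t : UnitAddCircle) + s)‖ ≤
            2 * ∫ s in {s : UnitAddCircle | infDist ((t : ℝ) : UnitAddCircle) C / 2 ≤ ‖s‖}, ‖kψ (k 1) s‖ := by
          simpa only [hkψ] using h1
        have htail' : ∫ s in {s : UnitAddCircle | infDist ((t : ℝ) : UnitAddCircle) C / 2 ≤ ‖s‖}, ‖kψ (k 1) s‖ ≤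
            π / (((P₂ (k 1) : ℝ) - P₁ (k 1)) * (infDist ((t : ℝ) : UnitAddCircle) C / 2)) := by
          simpa only [hkψ] using htail
        linarith
      -- rounding remainder
      have hU := abs_U_sub_tri_le_of_far P hδ₀ hd hN₀ hρN hM hMδ hfar2
      have h2 : ‖twist Ψ (k 1) ((t : ℝ) : UnitAddCircle) - g0 (k 1) (t : UnitAddCircle)‖ ≤
          2 * π * |((k 1 * G : ℤ) : ℝ)| * (Real.exp (-(M ^ 2 / 2)) / (2 * P.N j)) := by
        rw [twist_coe, hΨt, hγ, hg0t]
        have e1 : -(2 * ↑π * I * ((k 1 : ℤ) : ℂ) * (((G : ℝ) * P.U j t : ℝ) : ℂ)) =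
            -(2 * π * I * (((k 1 * G : ℤ) : ℝ) : ℂ) * ((P.U j t : ℝ) : ℂ)) := by push_cast; ring
        have e2 : -(2 * ↑π * I * ((k 1 * G : ℤ) : ℂ) * ((tri (2 * π * P.N j * t) / (2 * π * P.N j) : ℝ) : ℂ)) =
            -(2 * π * I * (((k 1 * G : ℤ) : ℝ) : ℂ) * ((tri (2 * π * P.N j * t) / (2 * π * P.N j) : ℝ) : ℂ)) := by
          push_cast; ring
        rw [e1, e2]
        refine (norm_exp_chirp_sub_le _ _ _).trans ?_
        exact mul_le_mul_of_nonneg_left hU (by positivity)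
      -- compare with the envelope off the core
      have hkε := hε k hk
      have hkAd := hAd k hk
      simp only [hρ]
      rw [hρoff _ hcore.le]
      have hmain : 2 * (π / (((P₂ (k 1) : ℝ) - P₁ (k 1)) * (infDist ((t : ℝ) : UnitAddCircle) C / 2))) ≤
          A * d₀ / infDist ((t : ℝ) : UnitAddCircle) C := by
        rw [le_div_iff₀ hdpos]
        have hI := hdpos.ne'
        have hD := hDk.ne'
        have : 2 * (π / (((P₂ (k 1) : ℝ) - P₁ (k 1)) * (infDist ((t : ℝ) : UnitAddCircle) C / 2))) * infDist ((t : ℝ) : UnitAddCircle) C =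
            4 * π / ((P₂ (k 1) : ℝ) - P₁ (k 1)) := by
          field_simp
          ring
        rw [this, div_le_iff₀ hDk]
        linarith
      simp only [hgmid]
      refine (norm_add_le _ _).trans ?_
      linarith [h1', h2, hmain]
  -- the window lemma
  have hmain := sum_window_sq_norm_comp_shearMap_le_fibre hTc hTs hθ₂c h10 Ψ W gmid grest hgmidc hgrestc hsplit hsep hρc hρ0 hbd
  rw [hsum] at hmain
  refine hmain.trans (pow_le_pow_left₀ (by positivity) (add_le_add ?_ le_rfl) 2)
  -- the zone term: kernel `L¹` norm (Fejér) × envelope mass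
  have hZ : ∫ x : UnitAddTorus (Fin 2), ρ (x 0) ^ 2 * ‖T x‖ ^ 2 ≤
      (∫ s : UnitAddCircle, ‖∑ l ∈ Finset.Icc (-(Q₂ : ℤ)) Q₂, χ l * fourier (-l) s‖) ^ 2 * 1 ^ 2 *
        ∫ bb : UnitAddCircle, ρ bb ^ 2 :=
    integral_weight_mul_norm_axisCutoff_sq_le hb hb1 0 χ _ hρc
  have hK : ∫ s : UnitAddCircle, ‖∑ l ∈ Finset.Icc (-(Q₂ : ℤ)) Q₂, χ l * fourier (-l) s‖ ≤ ((Q₁ : ℝ) + Q₂) / ((Q₂ : ℝ) - Q₁) :=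
    integral_norm_trapezoidKernel_le_ratio hQ hχ
  have hK0 : 0 ≤ ∫ s : UnitAddCircle, ‖∑ l ∈ Finset.Icc (-(Q₂ : ℤ)) Q₂, χ l * fourier (-l) s‖ :=
    integral_nonneg fun s => norm_nonneg _
  have hρ2 : ∫ bb : UnitAddCircle, ρ bb ^ 2 ≤ 2 * ε₀ ^ 2 + 2 * A ^ 2 * ((2 * P.N j : ℕ) * (2 * π * d₀)) := by
    have h := integral_envelope_sq_le CF hCFne hε0 hA0 hd₀
    refine h.trans ?_
    have : (CF.card : ℝ) * (2 * π * d₀) ≤ (2 * P.N j : ℕ) * (2 * π * d₀) :=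
      mul_le_mul_of_nonneg_right hCFcard (by positivity)
    nlinarith [sq_nonneg A]
  have hρ20 : 0 ≤ ∫ bb : UnitAddCircle, ρ bb ^ 2 := integral_nonneg fun bb => sq_nonneg _
  calc Real.sqrt (∫ x : UnitAddTorus (Fin 2), ρ (x 0) ^ 2 * ‖T x‖ ^ 2)
      ≤ Real.sqrt ((((Q₁ : ℝ) + Q₂) / ((Q₂ : ℝ) - Q₁)) ^ 2 * (2 * ε₀ ^ 2 + 2 * A ^ 2 * ((2 * P.N j : ℕ) * (2 * π * d₀)))) := by
        refine Real.sqrt_le_sqrt (hZ.trans ?_)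
        rw [one_pow, mul_one]
        exact mul_le_mul (pow_le_pow_left₀ hK0 hK 2) hρ2 hρ20 (sq_nonneg _)
    _ = (((Q₁ : ℝ) + Q₂) / ((Q₂ : ℝ) - Q₁)) * Real.sqrt (2 * ε₀ ^ 2 + 2 * A ^ 2 * ((2 * P.N j : ℕ) * (2 * π * d₀))) := by
        have hq : 0 ≤ ((Q₁ : ℝ) + Q₂) / ((Q₂ : ℝ) - Q₁) := by
          have : (Q₁ : ℝ) < Q₂ := by exact_mod_cast hQ
          exact div_nonneg (by positivity) (by linarith)
        rw [Real.sqrt_mul (sq_nonneg _), Real.sqrt_sq hq]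

end Summit.AnomalousDissipation.AnomalousDissipation.Theorems.SawtoothPulseCascade.K1Window
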